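import Summits.BirchSwinnertonDyer.Rank1Residual.X11b.Three.KolyvaginShaThreeRatDischarged
import Summits.BirchSwinnertonDyer.Rank1Residual.X11b.Three.KolyvaginShaThreeOfProp37
import Literature.NumberTheory.EllipticCurves.GrossLMS1991.HeegnerEulerSystemCongruenceImageFree
import HarnessLib

/-!
# `Ш(E/ℚ)[3^∞]` on the class X11b @ 3 ∩ (KN₃)/ℚ modulo NAMED published facts ONLY —
# Gross 1991 Prop. 3.7 (2) BY NAME; in particular clause (ii) of `BSD(E, 3)`,
# `Ш(E/ℚ)[3^∞]` finite, for EVERY `(E, 3)` in the class, with no inline cite-only hypothesis left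

Cell `b2b-bsdres`, team x11b3 (N8/O2 = X11b @ 3); seat x11b3-p2 GEN 53 (unit claimed D-0075 →
BSD:K2/P4 «Kolyvagin-in-kernel»).  Summit-side THEOREM-ONLY file (no definition, no named fact,
no `sorry`); `K : Type`; the literal prime `3`.

HONEST FRAMING (cell `b2b-bsdres`, run/shared/lean/b2b/bsd-rank1-residual/, verbatim in every
file): the goal of the cell is to DELETE the COMBINATION-SHAPED residual classes of the
Birch–Swinnerton-Dyer formula for ALL analytic-rank `≤ 1` elliptic curves over `ℚ` — "full BSD
formula for every rank `≤ 1` curve in class `C`" assembled STRICTLY from published theorems — so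
that the rank-`≤ 1` remainder becomes exactly the CONSTRUCTION-SHAPED classes, which are TYPED
(missing-input `Prop`s), NOT attempted.  This is not "finishing BSD".  Nothing here is booked; no
mark / label / count / tier moves; X11b @ 3 = O2/B10 stays OPEN / CONSTRUCTION-SHAPED (clause
(ii) of `BSDp W 3` is `Ш[3^∞]` finite; clause (iii), the `3`-part of the formula, is NOT touched —
Kolyvagin bounds `Ш` relative to the Heegner index).

WHAT THIS FILE DOES (b2b-bsdres REFEREE 2 GEN 192 nit n202, second half; lit GEN 154 P.S.,
HOME/INBOX 2026-08-27T12:26:08Z).  The four ℚ-side ENDs of `X11b/Three/KolyvaginShaThreeRatDischarged`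
(x11b3-p2 GEN 52) carry EXACTLY ONE inline cite-only binder `hγ` — Gross 1991 Prop. 3.7 (2) at
`p = 3` (for the class-level END: at every number field `K`).  That proposition is now the NAMED,
`[cite:]`-tagged Literature fact `GrossLMS1991.prop37_2_reductionCongruence N W K p` (lit GEN 154,
p530891, §E E622), and on the class X11b @ 3 ∩ (KN₃)/ℚ at `N = N_E` its six standing hypotheses
are tree theorems (`Three.KolyvaginDischarged.prop37_endBinder_three_of_classX11b`,
`X11b/Three/KolyvaginShaThreeOfProp37` §0).  THIS FILE re-issues the four ENDs with `hγ` TAKEN BY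
NAME — `(hγ : prop37_2_reductionCongruence N W K 3)`, resp. `∀ K, prop37_2_reductionCongruence N_E W K 3`
for the class-level END — every other binder and the conclusion VERBATIM, proof = the parent END
applied to §0.  HEADLINE (honest): `finite_primaryComponent_sha_three_of_classX11b_of_kodairaNeron_of_namedFacts`
— for EVERY `E/ℚ` (globally minimal model `W`) with `(E, 3) ∈ ClassX11b W 3` (`r_an = 1`, `3 ‖ N`,
`ρ̄_{E,3}` irreducible) on the Kodaira–Néron sub-class (KN₃)/ℚ, `Ш(E/ℚ)[3^∞]` is FINITE — clause
(ii) of `BSDp W 3` verbatim — CONDITIONAL on SIX NAMED PUBLISHED FACTS of the tree and NOTHING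
ELSE: `gross_zagier`, `hasEntireLFunction_rat`, `exists_isNewformOf`,
`HoffsteinLuo1997_exists_twist_L_one_ne_zero`, `mazur_not_dvd_maninConstant_of_odd`,
`GrossLMS1991.prop37_2_reductionCongruence` (∀ `K`); no `(K, y_K)` datum, no inline hypothesis, no
image rider.  A conditional result on cited published statements (D-0014 named facts), not an
unconditional theorem; the six facts are NOT discharged here; nothing booked.

## What is proved (namespace `Summit.BirchSwinnertonDyer.Rank1Residual.X11b.Three.KolyvaginDischarged`)

* `finite_primaryComponent_sha_three_of_classX11b_of_kodairaNeron_rat_of_prop37` — with `(K, y_K)`: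
  `Ш(E/ℚ)[3^∞]` finite, modulo the named fact at `3` + `hN` + (KN₃)/ℚ.
* `pow_smul_sha_rat_three_primary_eq_zero_of_classX11b_of_kodairaNeron_rat_of_prop37` —
  `3^{m+1} ∤ y_K ⟹ 3^{2m} · Ш(E/ℚ)[3^∞] = 0`, same footing.
* `primaryComponent_sha_three_eq_bot_of_classX11b_of_kodairaNeron_rat_of_not_dvd_of_prop37` —
  `3 ∤ y_K ⟹ Ш(E/ℚ)[3^∞] = 0`, same footing.
* `finite_primaryComponent_sha_three_of_classX11b_of_kodairaNeron_of_namedFacts` — the class-level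
  END: `Ш(E/ℚ)[3^∞]` finite on ClassX11b W 3 ∩ (KN₃)/ℚ modulo six NAMED facts, no `(K, y_K)`.
* `finite_primaryComponent_sha_three_of_classX11b_of_kodairaNeron_of_namedFacts'` — the same keyed
  to the image-free CLOSED sibling `GrossLMS1991.prop37_2_frobeniusCongruence` (Nekovář 2007 Prop.
  4.9 / 4.13 (ii); §E E659): six closed named facts of `Literature/`, nothing else.

## References

* [GrossLMS1991] B. H. Gross, LMS LNS 153 (1991), §1 (p. 235), §2 (p. 237), Prop. 2.1 (2), §3
  Prop. 3.7 (2) (p. 240), Prop. 5.3, Thm. 1.3 (2).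
* [McCallumLMS1991] W. G. McCallum, same volume, §1 Theorem (Kolyvagin), Lemma 5.1.
* [Miller2011LMS] R. L. Miller, LMS J. Comput. Math. 14 (2011), Def. 1.1 (ii).
* [HoffsteinLuo1997] Math. Res. Lett. 4 (1997), Theorem (§1). [GrossZagier1986] I (6.3), III (3.1).
* [SerreGaloisCohomology1997] I.§2.4. [Serre1972] §2.4 Prop. 15. [Nekovar2007] Prop. 4.9, 4.13 (ii).

presearch: `lean search 'of_prop37|of_namedFacts'` → none in X11b; `lean search
'prop37_2_reductionCongruence'` → the fact file + its image-free sibling; parents = the tree ENDs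
named above; §0 = `X11b/Three/KolyvaginShaThreeOfProp37`; nothing minted.
-/

noncomputable section

open scoped Classical
open WeierstrassCurve Field NumberField IsDedekindDomain
open Literature.NumberTheory.EllipticCurves Literature.NumberTheory.GaloisRepresentations
open Literature.NumberTheory.EllipticCurves.Rank1Residual
open Literature.NumberTheory.EllipticCurves.RingClassField
open Literature.NumberTheory.EllipticCurves.ModularForms
open Literature.NumberTheory.DiophantineGeometry Literature.NumberTheory.DiophantineGeometry.TateAlgorithm
open Literature.NumberTheory.EllipticCurves.GrossLMS1991 (prop37_2_reductionCongruence
  prop37_2_frobeniusCongruence prop37_2_reductionCongruence_of_frobeniusCongruence)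

namespace Summit.BirchSwinnertonDyer.Rank1Residual.X11b.Three.KolyvaginDischarged

-- `K : Type`: the tree's ring-class class field theory is universe `0`.
variable {K : Type} [Field K] [NumberField K] {N : ℕ} {W : WeierstrassCurve ℚ}

/-- **On the class X11b @ 3 ∩ (KN₃)/ℚ, `Ш(E/ℚ)[3^∞]` is finite — clause (ii) of Miller's
`BSD(E, 3)` — modulo the NAMED fact `GrossLMS1991.prop37_2_reductionCongruence N W K 3`, no inline
cite-only input.**  The tree END `finite_primaryComponent_sha_three_of_classX11b_of_kodairaNeron_rat`
(`X11b/Three/KolyvaginShaThreeRatDischarged`) with its inline binder `hγ` SUPPLIED by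
`prop37_endBinder_three_of_classX11b`; every other binder and the conclusion VERBATIM.  For
`(E, 3) ∈ ClassX11b W 3` at `N = N_E` (`hN`), (KN₃)/ℚ (`hKN3m`, `hKN3a`), ANY `K : Type` imaginary
quadratic with the Heegner hypothesis and a non-torsion Heegner point `P`:
`Finite (AddCommGroup.primaryComponent W.sha 3)`.  CONDITIONAL on EXACTLY the named fact {`hγ`}
at `3` (PUBLISHED, NOT discharged) + `hN` + (KN₃)/ℚ; `(K, P)` NOT supplied; nothing booked; no
mark / count / tier moves.
[cite: Miller2011LMS, Def. 1.1 (ii)] [cite: McCallumLMS1991, §1 Theorem (Kolyvagin)]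
[cite: GrossLMS1991, §3 Prop. 3.7 (2) (p. 240)] [cite: SerreGaloisCohomology1997, I.§2.4] -/
theorem finite_primaryComponent_sha_three_of_classX11b_of_kodairaNeron_rat_of_prop37 [NeZero N]
    [W.IsGloballyMinimal] (hW : ClassX11b W 3) (hN : ∀ [W.IsElliptic], N = W.conductorNorm ℤ)
    (hKN3m : ∀ [W.IsElliptic] (v : HeightOneSpectrum (𝓞 ℚ)),
      W.HasMultiplicativeReductionAt v → ¬ 3 ∣ W.ordMinimalDiscriminant v)
    (hKN3a : ∀ [W.IsElliptic] (v : HeightOneSpectrum (𝓞 ℚ)), W.HasAdditiveReductionAt v →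
      W.kodairaSymbolAt v ≠ KodairaSymbol.IV ∧ W.kodairaSymbolAt v ≠ KodairaSymbol.IVstar)
    (hγ : prop37_2_reductionCongruence N W K 3) :
    ∀ [W.IsElliptic] (_hK : IsImaginaryQuadratic K) (_hH : SatisfiesHeegnerHypothesis N K)
      {P : (W.baseChange K).toAffine.Point} (_hP : IsHeegnerPoint N W K P)
      (_hnt : ¬ IsOfFinAddOrder P), Finite (AddCommGroup.primaryComponent W.sha 3) :=
  finite_primaryComponent_sha_three_of_classX11b_of_kodairaNeron_rat hW hN hKN3m hKN3a
    (prop37_endBinder_three_of_classX11b hW hN hKN3m hγ)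

/-- **On the class X11b @ 3 ∩ (KN₃)/ℚ, `3^{2m} · Ш(E/ℚ)[3^∞] = 0` for every `m` with
`3^{m+1} ∤ y_K` in `E(K)` — modulo the NAMED fact `GrossLMS1991.prop37_2_reductionCongruence N W K 3`**
(the EXPONENT form over `ℚ` of McCallum's §1 Theorem with Lemma 5.1).  The tree END
`pow_smul_sha_rat_three_primary_eq_zero_of_classX11b_of_kodairaNeron_rat`
(`X11b/Three/KolyvaginShaThreeRatDischarged`) with `hγ` SUPPLIED by
`prop37_endBinder_three_of_classX11b`; binders/conclusion otherwise VERBATIM.  CONDITIONAL on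
EXACTLY the named fact {`hγ`} at `3` + `hN` + (KN₃)/ℚ; nothing booked; no mark.
[cite: McCallumLMS1991, §1 Theorem (Kolyvagin), Lemma 5.1] [cite: GrossLMS1991, §3 Prop. 3.7 (2) (p. 240)]
[cite: SerreGaloisCohomology1997, I.§2.4] -/
theorem pow_smul_sha_rat_three_primary_eq_zero_of_classX11b_of_kodairaNeron_rat_of_prop37 [NeZero N]
    [W.IsGloballyMinimal] (hW : ClassX11b W 3) (hN : ∀ [W.IsElliptic], N = W.conductorNorm ℤ)
    (hKN3m : ∀ [W.IsElliptic] (v : HeightOneSpectrum (𝓞 ℚ)),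
      W.HasMultiplicativeReductionAt v → ¬ 3 ∣ W.ordMinimalDiscriminant v)
    (hKN3a : ∀ [W.IsElliptic] (v : HeightOneSpectrum (𝓞 ℚ)), W.HasAdditiveReductionAt v →
      W.kodairaSymbolAt v ≠ KodairaSymbol.IV ∧ W.kodairaSymbolAt v ≠ KodairaSymbol.IVstar)
    (hγ : prop37_2_reductionCongruence N W K 3) :
    ∀ [W.IsElliptic] (_hK : IsImaginaryQuadratic K) (_hH : SatisfiesHeegnerHypothesis N K)
      {P : (W.baseChange K).toAffine.Point} (_hP : IsHeegnerPoint N W K P)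
      (_hnt : ¬ IsOfFinAddOrder P) {m : ℕ}
      (_hm : ∀ Q : (W.baseChange K).toAffine.Point, 3 ^ (m + 1) • Q ≠ P) (c : W.sha),
      (∃ j : ℕ, 3 ^ j • c = 0) → 3 ^ (2 * m) • c = 0 :=
  pow_smul_sha_rat_three_primary_eq_zero_of_classX11b_of_kodairaNeron_rat hW hN hKN3m hKN3a
    (prop37_endBinder_three_of_classX11b hW hN hKN3m hγ)

/-- **On the class X11b @ 3 ∩ (KN₃)/ℚ: `3 ∤ y_K` in `E(K)` ⟹ `Ш(E/ℚ)[3^∞] = 0`** (Mathlib: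
`AddCommGroup.primaryComponent W.sha 3 = ⊥`; Gross 1991 Prop. 2.1 (2) at `p = 3` descended to
`ℚ`) — modulo the NAMED fact `GrossLMS1991.prop37_2_reductionCongruence N W K 3`.  The tree END
`primaryComponent_sha_three_eq_bot_of_classX11b_of_kodairaNeron_rat_of_not_dvd`
(`X11b/Three/KolyvaginShaThreeRatDischarged`) with `hγ` SUPPLIED by
`prop37_endBinder_three_of_classX11b`; binders/conclusion otherwise VERBATIM.  CONDITIONAL on
EXACTLY the named fact {`hγ`} at `3` + `hN` + (KN₃)/ℚ; nothing booked; no mark.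
[cite: GrossLMS1991, Prop. 2.1 (2), §3 Prop. 3.7 (2) (p. 240)] [cite: SerreGaloisCohomology1997, I.§2.4] -/
theorem primaryComponent_sha_three_eq_bot_of_classX11b_of_kodairaNeron_rat_of_not_dvd_of_prop37 [NeZero N]
    [W.IsGloballyMinimal] (hW : ClassX11b W 3) (hN : ∀ [W.IsElliptic], N = W.conductorNorm ℤ)
    (hKN3m : ∀ [W.IsElliptic] (v : HeightOneSpectrum (𝓞 ℚ)),
      W.HasMultiplicativeReductionAt v → ¬ 3 ∣ W.ordMinimalDiscriminant v)
    (hKN3a : ∀ [W.IsElliptic] (v : HeightOneSpectrum (𝓞 ℚ)), W.HasAdditiveReductionAt v →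
      W.kodairaSymbolAt v ≠ KodairaSymbol.IV ∧ W.kodairaSymbolAt v ≠ KodairaSymbol.IVstar)
    (hγ : prop37_2_reductionCongruence N W K 3) :
    ∀ [W.IsElliptic] (_hK : IsImaginaryQuadratic K) (_hH : SatisfiesHeegnerHypothesis N K)
      {P : (W.baseChange K).toAffine.Point} (_hP : IsHeegnerPoint N W K P)
      (_hnt : ¬ IsOfFinAddOrder P) (_h3 : ∀ Q : (W.baseChange K).toAffine.Point, 3 • Q ≠ P),
      AddCommGroup.primaryComponent W.sha 3 = ⊥ :=
  primaryComponent_sha_three_eq_bot_of_classX11b_of_kodairaNeron_rat_of_not_dvd hW hN hKN3m hKN3a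
    (prop37_endBinder_three_of_classX11b hW hN hKN3m hγ)

/-- **On the class X11b @ 3 ∩ (KN₃)/ℚ, `Ш(E/ℚ)[3^∞]` is finite — clause (ii) of `BSD(E, 3)`
(`BSDp W 3`) VERBATIM — from SIX NAMED PUBLISHED FACTS and nothing else: NO `(K, y_K)` hypothesis,
NO inline cite-only input, NO image rider.**  The tree END
`finite_primaryComponent_sha_three_of_classX11b_of_kodairaNeron_of_facts`
(`X11b/Three/KolyvaginShaThreeRatDischarged`: named facts {`hGZ`, `hmod`, `hnf`, `hHL`, `hMaz`} +
the inline `hγ` ∀ `K`) with `hγ` TAKEN BY NAME at every `K : Type` —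
`GrossLMS1991.prop37_2_reductionCongruence (W.conductorNorm ℤ) W K 3`, turned into the END binder by
`prop37_endBinder_three_of_classX11b` (its six standing hypotheses are theorems on the class at
`N = N_E`).  Data as in the parent: a Hoffstein–Luo Heegner field `K`, its Heegner point
non-torsion by Gross–Zagier (`r_an = 1`).  For EVERY `E/ℚ` (globally minimal `W`) with
`(E, 3) ∈ ClassX11b W 3` (`r_an = 1`, `3 ‖ N`, `ρ̄_{E,3}` irreducible) and (KN₃)/ℚ (`hKN3m`: `3 ∤
ord_ℓ Δ_min` at multiplicative `ℓ`; `hKN3a`: no IV / IV* additive place):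
`Finite (AddCommGroup.primaryComponent W.sha 3)`.  CONDITIONAL on EXACTLY the named facts
{`gross_zagier` (∀ `N W K`), `hasEntireLFunction_rat`, `exists_isNewformOf`,
`HoffsteinLuo1997_exists_twist_L_one_ne_zero`, `mazur_not_dvd_maninConstant_of_odd`,
`GrossLMS1991.prop37_2_reductionCongruence` (∀ `K`)} — all PUBLISHED, citation-tagged `def … :
Prop`s of `Literature/`, none discharged here — + (KN₃)/ℚ.  A conditional result (D-0014 named
facts), not an unconditional theorem; clause (iii) of `BSDp W 3` untouched; nothing booked; no
mark / count / tier moves.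
[cite: Miller2011LMS, Def. 1.1 (ii)] [cite: HoffsteinLuo1997, Theorem (§1)]
[cite: GrossZagier1986, I (6.3)] [cite: McCallumLMS1991, §1 Theorem (Kolyvagin)]
[cite: GrossLMS1991, §3 Prop. 3.7 (2) (p. 240), §1 (p. 235), §2 (p. 237)] [cite: Serre1972, §2.4 Prop. 15] -/
theorem finite_primaryComponent_sha_three_of_classX11b_of_kodairaNeron_of_namedFacts [W.IsElliptic]
    [W.IsGloballyMinimal] [NeZero (W.conductorNorm ℤ)] (hX : ClassX11b W 3)
    -- published inputs (named facts of the tree)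
    (hGZ : ∀ (N : ℕ) [NeZero N] (W : WeierstrassCurve ℚ) (K : Type) [Field K] [NumberField K],
      gross_zagier N W K)
    (hmod : hasEntireLFunction_rat) (hnf : exists_isNewformOf)
    (hHL : HoffsteinLuo1997_exists_twist_L_one_ne_zero) (hMaz : mazur_not_dvd_maninConstant_of_odd)
    -- the Kodaira–Néron sub-class (KN₃)/ℚ
    (hKN3m : ∀ [W.IsElliptic] (v : HeightOneSpectrum (𝓞 ℚ)),
      W.HasMultiplicativeReductionAt v → ¬ 3 ∣ W.ordMinimalDiscriminant v)
    (hKN3a : ∀ [W.IsElliptic] (v : HeightOneSpectrum (𝓞 ℚ)), W.HasAdditiveReductionAt v →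
      W.kodairaSymbolAt v ≠ KodairaSymbol.IV ∧ W.kodairaSymbolAt v ≠ KodairaSymbol.IVstar)
    -- Gross 1991 Prop. 3.7 (2) AT 3, BY NAME, for every number field `K`
    (hγ : ∀ (K : Type) [Field K] [NumberField K],
      prop37_2_reductionCongruence (W.conductorNorm ℤ) W K 3) :
    Finite (AddCommGroup.primaryComponent W.sha 3) :=
  finite_primaryComponent_sha_three_of_classX11b_of_kodairaNeron_of_facts hX hGZ hmod hnf hHL hMaz
    hKN3m hKN3a
    (fun K _ _ ↦ prop37_endBinder_three_of_classX11b (K := K) (N := W.conductorNorm ℤ) hX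
      (@fun _ ↦ rfl) hKN3m (hγ K))

/-- **The same class-level END keyed to the CLOSED image-free print of the congruence** —
`GrossLMS1991.prop37_2_frobeniusCongruence` (Gross 1991 Prop. 3.7 (2) = Nekovář 2007 Prop. 4.9 /
4.13 (ii) for `X_0(N)`, no image / CM hypothesis; bsd-stepL-lit g24, p534286, §E E659), which implies
`prop37_2_reductionCongruence N W K p` at every `(N, W, K, p)` by the tree theorem
`prop37_2_reductionCongruence_of_frobeniusCongruence`.  For EVERY `E/ℚ` (globally minimal `W`)
with `(E, 3) ∈ ClassX11b W 3` and (KN₃)/ℚ: `Finite (AddCommGroup.primaryComponent W.sha 3)` —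
clause (ii) of `BSDp W 3` — CONDITIONAL on EXACTLY SIX CLOSED NAMED PUBLISHED FACTS of `Literature/`
{`gross_zagier` (∀ `N W K`), `hasEntireLFunction_rat`, `exists_isNewformOf`,
`HoffsteinLuo1997_exists_twist_L_one_ne_zero`, `mazur_not_dvd_maninConstant_of_odd`,
`prop37_2_frobeniusCongruence`} and nothing else (no `(K, y_K)`, no inline hypothesis, no image
rider); none discharged here; a conditional result (D-0014), not an unconditional theorem; clause
(iii) untouched; nothing booked; no mark / count / tier moves.
[cite: Miller2011LMS, Def. 1.1 (ii)] [cite: Nekovar2007, Prop. 4.9 and Prop. 4.13 (ii)]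
[cite: GrossLMS1991, §3 Prop. 3.7 (2) (p. 240)] [cite: HoffsteinLuo1997, Theorem (§1)]
[cite: GrossZagier1986, I (6.3)] [cite: McCallumLMS1991, §1 Theorem (Kolyvagin)] -/
theorem finite_primaryComponent_sha_three_of_classX11b_of_kodairaNeron_of_namedFacts' [W.IsElliptic]
    [W.IsGloballyMinimal] [NeZero (W.conductorNorm ℤ)] (hX : ClassX11b W 3)
    -- published inputs (named facts of the tree)
    (hGZ : ∀ (N : ℕ) [NeZero N] (W : WeierstrassCurve ℚ) (K : Type) [Field K] [NumberField K],
      gross_zagier N W K)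
    (hmod : hasEntireLFunction_rat) (hnf : exists_isNewformOf)
    (hHL : HoffsteinLuo1997_exists_twist_L_one_ne_zero) (hMaz : mazur_not_dvd_maninConstant_of_odd)
    (hγ : prop37_2_frobeniusCongruence)
    -- the Kodaira–Néron sub-class (KN₃)/ℚ
    (hKN3m : ∀ [W.IsElliptic] (v : HeightOneSpectrum (𝓞 ℚ)),
      W.HasMultiplicativeReductionAt v → ¬ 3 ∣ W.ordMinimalDiscriminant v)
    (hKN3a : ∀ [W.IsElliptic] (v : HeightOneSpectrum (𝓞 ℚ)), W.HasAdditiveReductionAt v →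
      W.kodairaSymbolAt v ≠ KodairaSymbol.IV ∧ W.kodairaSymbolAt v ≠ KodairaSymbol.IVstar) :
    Finite (AddCommGroup.primaryComponent W.sha 3) :=
  finite_primaryComponent_sha_three_of_classX11b_of_kodairaNeron_of_namedFacts hX hGZ hmod hnf hHL
    hMaz hKN3m hKN3a
    (fun K _ _ ↦ prop37_2_reductionCongruence_of_frobeniusCongruence hγ (W.conductorNorm ℤ) W K 3)

end Summit.BirchSwinnertonDyer.Rank1Residual.X11b.Three.KolyvaginDischarged

end
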